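import Summits.QuantumFields.BalabanUV.T4Continuum.Support.NE7FrameDefectLipschitz
import HarnessLib

/-!
# NE7FrameDefectLipschitzRadius — (LP′): the Lipschitz letter of `NE7FrameDefectLipschitz` AT A FIXED REGIME RADIUS — `‖P(X′)(z) − P(X)(z)‖ ≤ 4·C_Γ·(L^{k+1})²·b₁·‖X′ − X‖_∞` for every
# `b₁ ≥ 2(‖X‖_∞ + ‖X′ − X‖_∞)` at which the Prop-4 regime holds (so an orbit carries ONE regime radius, not one per step)

Cell `pub-balaban`, rung (B)+1 sub-cell t4, lineage `b2b-balaban-t4-ne7-p1`, generation 103 (CRUX PROVER NE7 #1 = OWNER of BINDER row NE7).  Memo `t4/b2b-balaban-t4-ne7-p1-g103/ROAD-G103.md` §3.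
Same proof as `NE7FrameDefectLipschitz.norm_frameDefect_sub_le` (analyticity of `t ↦ P(X + t•D)(z)` + the sup letter on complex fields + Schwarz), with the ball radius `R₁ := (b₁ − b)∕δ`
(`≥ 2`, since `b + 2δ ≤ b₁`): on the ball the sup stays `< b₁`, the range stays in the closed ball of radius `2C_Γ(L^{k+1}b₁)²`, and `R₂∕R₁ = 2C_Γ(L^{k+1})²b₁²δ∕(b₁ − b) ≤ 4C_Γ(L^{k+1})²b₁δ`.
WHAT ([folklore]; 0 def, 0 sorry).  **`norm_frameDefect_sub_le_of_radius`** (`X`, `X + D`), **`norm_frameDefect_sub_frameDefect_le_of_radius`** (`X`, `X′`).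
HONEST FRAMING (page 1): calculus of OUR objects over landed kernel theorems; nothing of Bałaban's asserted; NOT the re-issued (S1), NOT NE7; spine 0∕9; finite T⁴ rung (B)+1 — NOT infinite volume, NOT mass
gap, NOT BetaPertH, NOT Clay.  Continuum YM on T⁴ ⇐ BetaPertH ∧ nine spine estimates (0/9 proved); BetaPertH ⇐ (D1) ∧ (D4) ∧ CAP+tail; G-an2-4 gates asym, D1 and NE2/3/4.
-/

set_option autoImplicit false

open scoped BigOperators Matrix Matrix.Norms.L2Operator Topology
open NormedSpace Finset Metric Set

namespace Summit.QuantumFields.BalabanUV.T4Continuum.NE7FrameDefectLipschitzRadius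

open Literature.MathematicalPhysics.QuantumFieldTheory.Balaban1983to89
open B7Prop1Explicit B7Prop2Explicit B7Prop3Flat MatrixLog
open B7Eq92Concrete (vcov)
open T4AveragingDeficitWall (IsUnitaryCfg SmallField)
open AveragingDeficitMultiLevelPrep (LevelSmall)
open NE3TangentCovariantTower (framePotW)
open NE3.PairLandauB8Avg (relPert)
open NE7FrameDefectLipschitz (norm_line_le analyticAt_mlog_vcov_line framePotW_line)

noncomputable section

variable {d : ℕ} {n : Type*} [Fintype n] [DecidableEq n]

section Radius

variable [Nonempty n] {L : ℕ} (hL : 2 ≤ L) (k : ℕ) {W : Site d → Fin d → (Matrix n n ℂ)ˣ} (hWu : IsUnitaryCfg W)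
  {α₀ : ℝ} (hα : 0 < α₀) (hα3 : C0 d * α₀ ≤ 1 / 3) (hα4 : 4 * α₀ ≤ c2' d L) (h52 : pdev W < α₀ * (((L : ℝ) ^ (k + 1))⁻¹) ^ 2)

include hL hWu hα hα3 hα4 h52 in
/-- **(LP′) — THE FRAME DEFECT IS LIPSCHITZ WITH CONSTANT `4C_Γ(L^{k+1})²b₁` AT ANY REGIME RADIUS `b₁ ≥ 2(b + δ)`**: multi-level small-field class at `W`, Prop-4 regime at radius `b₁`
(`2048·d·L^{k+1}b₁ ≤ 1` etc.), fields `X, D` with `sup‖X‖ ≤ b`, `sup‖D‖ ≤ δ`, `2(b + δ) ≤ b₁`: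
`‖(mlog v_{k+1}(X + D)(z) − framePotW (X + D) z) − (mlog v_{k+1}(X)(z) − framePotW X z)‖ ≤ 4·C_Γ·(L^{k+1})²·b₁·δ`, `C_Γ = 56(dL)² + 16C₁dL`. [folklore] -/
theorem norm_frameDefect_sub_le_of_radius (κ₀ : Fin d) {x : ℝ} (hx : 0 ≤ x) (hs : LevelSmall d L k x) (hWx : SmallField W x)
    {X D : Site d → Fin d → Matrix n n ℂ} {b δ b₁ : ℝ} (hb : 0 ≤ b) (hδ : 0 ≤ δ) (hX : ∀ y κ, ‖X y κ‖ ≤ b) (hD : ∀ y κ, ‖D y κ‖ ≤ δ) (hb₁ : 2 * (b + δ) ≤ b₁)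
    (hsmall : Real.exp (4 * (800 * ((d : ℝ) + 1) ^ 2 * ((d : ℝ) + 4)) * α₀)
      * (1 + 8 * (131072 * ((d : ℝ) + 1) ^ 2) * ((L : ℝ) ^ (k + 1) * b₁)) ≤ 2)
    (hc₃ : 2 * ((L : ℝ) ^ (k + 1) * b₁) ≤ c3 d L) (h100 : 100 * ((d : ℝ) * L * ((L : ℝ) ^ (k + 1) * b₁)) ≤ 1)
    (hC16 : 16 * (131072 * ((d : ℝ) + 1) ^ 2) * ((L : ℝ) ^ (k + 1) * b₁) ≤ 1) (hsm : 2048 * (d : ℝ) * ((L : ℝ) ^ (k + 1) * b₁) ≤ 1) (z : Site d) :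
    ‖(mlog ((vcov L W (relPert W (fun y κ => X y κ + D y κ)) (k + 1) z : (Matrix n n ℂ)ˣ) : Matrix n n ℂ) - framePotW L (k + 1) W (fun y κ => X y κ + D y κ) z)
        - (mlog ((vcov L W (relPert W X) (k + 1) z : (Matrix n n ℂ)ˣ) : Matrix n n ℂ) - framePotW L (k + 1) W X z)‖
      ≤ 4 * (56 * ((d : ℝ) * L) ^ 2 + 16 * (131072 * ((d : ℝ) + 1) ^ 2) * ((d : ℝ) * L)) * ((L : ℝ) ^ (k + 1)) ^ 2 * b₁ * δ := by
  letI : CStarAlgebra (Matrix n n ℂ) := {}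
  have hL1 : 1 ≤ L := by omega
  set CΓ : ℝ := 56 * ((d : ℝ) * L) ^ 2 + 16 * (131072 * ((d : ℝ) + 1) ^ 2) * ((d : ℝ) * L) with hCΓ
  have hCΓ0 : 0 ≤ CΓ := by positivity
  have hb₁0 : 0 ≤ b₁ := by linarith
  -- the sup letter for every COMPLEX field of sup `≤ b₁`
  have hP : ∀ Y : Site d → Fin d → Matrix n n ℂ, (∀ y κ, ‖Y y κ‖ ≤ b₁) →
      ‖mlog ((vcov L W (relPert W Y) (k + 1) z : (Matrix n n ℂ)ˣ) : Matrix n n ℂ) - framePotW L (k + 1) W Y z‖ ≤ CΓ * ((L : ℝ) ^ (k + 1) * b₁) ^ 2 :=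
    fun Y hY => NE7AccumulatedFrameLinearisation.norm_mlog_vcov_sub_framePotW_le hL (k + 1) hWu hα hα3 hα4 h52 hb₁0 hY hsmall hc₃ h100 hC16 z
  -- the degenerate case `δ = 0`
  rcases hδ.eq_or_lt with hδ0 | hδpos
  · have hD0 : ∀ y κ, D y κ = 0 := fun y κ => norm_le_zero_iff.mp (hδ0 ▸ hD y κ)
    have e : (fun y κ => X y κ + D y κ) = X := by funext y κ; rw [hD0, add_zero]
    rw [e, sub_self, norm_zero, ← hδ0]; positivity
  -- the holomorphic function on the ball `‖t‖ < R₁ := (b₁ − b)/δ`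
  set R₁ : ℝ := (b₁ - b) / δ with hR₁
  have hR₁δ : R₁ * δ = b₁ - b := by rw [hR₁]; field_simp
  have hR₁2 : 2 ≤ R₁ := by rw [hR₁, le_div_iff₀ hδpos]; linarith
  have hR₁pos : 0 < R₁ := by linarith
  set f : ℂ → Matrix n n ℂ := fun t => mlog ((vcov L W (relPert W (fun y κ => X y κ + t • D y κ)) (k + 1) z : (Matrix n n ℂ)ˣ) : Matrix n n ℂ)
    - framePotW L (k + 1) W (fun y κ => X y κ + t • D y κ) z with hf
  have hsup : ∀ t : ℂ, ‖t‖ < R₁ → ∀ y κ, ‖X y κ + t • D y κ‖ ≤ b + ‖t‖ * δ := fun t _ y κ => norm_line_le hX hD t y κ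
  have hlt : ∀ t : ℂ, ‖t‖ < R₁ → b + ‖t‖ * δ < b₁ := by
    intro t ht
    have : ‖t‖ * δ < R₁ * δ := mul_lt_mul_of_pos_right ht hδpos
    rw [hR₁δ] at this; linarith
  have hdiff : DifferentiableOn ℂ f (ball (0 : ℂ) R₁) := by
    intro t ht
    have ht' : ‖t‖ < R₁ := by simpa using ht
    have han : AnalyticAt ℂ f t := by
      have h1 := analyticAt_mlog_vcov_line hL k hWu hα hα3 hα4 h52 κ₀ hδ hD (hlt t ht') (hsup t ht') hsmall hc₃ hsm z
      have h2 : AnalyticAt ℂ (fun s : ℂ => framePotW L (k + 1) W X z + s • framePotW L (k + 1) W D z) t :=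
        analyticAt_const.add (analyticAt_id.smul analyticAt_const)
      have e : f = fun s => mlog ((vcov L W (relPert W (fun y κ => X y κ + s • D y κ)) (k + 1) z : (Matrix n n ℂ)ˣ) : Matrix n n ℂ)
          - (framePotW L (k + 1) W X z + s • framePotW L (k + 1) W D z) := by
        funext s
        simp only [hf]
        rw [framePotW_line hL1 k hWu hx hs hWx X D s z]
      rw [e]; exact h1.sub h2
    exact han.differentiableAt.differentiableWithinAt
  set R₂ : ℝ := 2 * (CΓ * ((L : ℝ) ^ (k + 1) * b₁) ^ 2) with hR₂
  have eX0 : (fun y κ => X y κ + (0 : ℂ) • D y κ) = X := by funext y κ; rw [zero_smul, add_zero]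
  have eX1 : (fun y κ => X y κ + (1 : ℂ) • D y κ) = fun y κ => X y κ + D y κ := by funext y κ; rw [one_smul]
  have hf0 : ‖f 0‖ ≤ CΓ * ((L : ℝ) ^ (k + 1) * b₁) ^ 2 := by
    simp only [hf, eX0]
    exact hP X fun y κ => (hX y κ).trans (by linarith [(norm_nonneg _).trans (hD y κ)])
  have hmaps : MapsTo f (ball (0 : ℂ) R₁) (closedBall (f 0) R₂) := by
    intro t ht
    have ht' : ‖t‖ < R₁ := by simpa using ht
    have hft : ‖f t‖ ≤ CΓ * ((L : ℝ) ^ (k + 1) * b₁) ^ 2 :=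
      hP (fun y κ => X y κ + t • D y κ) fun y κ => (hsup t ht' y κ).trans (hlt t ht').le
    rw [mem_closedBall, dist_eq_norm]
    calc ‖f t - f 0‖ ≤ ‖f t‖ + ‖f 0‖ := norm_sub_le _ _
      _ ≤ R₂ := by rw [hR₂]; linarith
  have h1mem : (1 : ℂ) ∈ ball (0 : ℂ) R₁ := by simp; linarith
  have hS := Complex.dist_le_div_mul_dist_of_mapsTo_ball hdiff hmaps h1mem
  rw [dist_eq_norm, dist_zero_right, norm_one, mul_one] at hS
  have ef1 : f 1 = mlog ((vcov L W (relPert W (fun y κ => X y κ + D y κ)) (k + 1) z : (Matrix n n ℂ)ˣ) : Matrix n n ℂ)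
      - framePotW L (k + 1) W (fun y κ => X y κ + D y κ) z := by
    simp only [hf, eX1]
  have ef0 : f 0 = mlog ((vcov L W (relPert W X) (k + 1) z : (Matrix n n ℂ)ˣ) : Matrix n n ℂ) - framePotW L (k + 1) W X z := by
    simp only [hf, eX0]
  rw [ef1, ef0] at hS
  refine hS.trans ?_
  -- `R₂ / R₁ = 2 C_Γ (L^{k+1} b₁)² δ / (b₁ − b) ≤ 4 C_Γ (L^{k+1})² b₁ δ` since `b₁ − b ≥ b₁ / 2`
  have hbb : b₁ / 2 ≤ b₁ - b := by linarith
  have hR₁' : R₁ = (b₁ - b) / δ := hR₁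
  rw [div_le_iff₀ hR₁pos, hR₂, hR₁']
  rw [show 4 * CΓ * ((L : ℝ) ^ (k + 1)) ^ 2 * b₁ * δ * ((b₁ - b) / δ) = 4 * CΓ * ((L : ℝ) ^ (k + 1)) ^ 2 * b₁ * (b₁ - b) by field_simp]
  have hM : 0 ≤ CΓ * ((L : ℝ) ^ (k + 1)) ^ 2 * b₁ := by positivity
  nlinarith [mul_le_mul_of_nonneg_left hbb hM]

include hL hWu hα hα3 hα4 h52 in
/-- **(LP′), two-field form**: `‖P(X′)(z) − P(X)(z)‖ ≤ 4·C_Γ·(L^{k+1})²·b₁·δ` for `sup‖X‖ ≤ b`, `sup‖X′ − X‖ ≤ δ`, `2(b + δ) ≤ b₁`, regime at `b₁`. [folklore] -/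
theorem norm_frameDefect_sub_frameDefect_le_of_radius (κ₀ : Fin d) {x : ℝ} (hx : 0 ≤ x) (hs : LevelSmall d L k x) (hWx : SmallField W x)
    {X X' : Site d → Fin d → Matrix n n ℂ} {b δ b₁ : ℝ} (hb : 0 ≤ b) (hδ : 0 ≤ δ) (hX : ∀ y κ, ‖X y κ‖ ≤ b) (hD : ∀ y κ, ‖X' y κ - X y κ‖ ≤ δ) (hb₁ : 2 * (b + δ) ≤ b₁)
    (hsmall : Real.exp (4 * (800 * ((d : ℝ) + 1) ^ 2 * ((d : ℝ) + 4)) * α₀)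
      * (1 + 8 * (131072 * ((d : ℝ) + 1) ^ 2) * ((L : ℝ) ^ (k + 1) * b₁)) ≤ 2)
    (hc₃ : 2 * ((L : ℝ) ^ (k + 1) * b₁) ≤ c3 d L) (h100 : 100 * ((d : ℝ) * L * ((L : ℝ) ^ (k + 1) * b₁)) ≤ 1)
    (hC16 : 16 * (131072 * ((d : ℝ) + 1) ^ 2) * ((L : ℝ) ^ (k + 1) * b₁) ≤ 1) (hsm : 2048 * (d : ℝ) * ((L : ℝ) ^ (k + 1) * b₁) ≤ 1) (z : Site d) :
    ‖(mlog ((vcov L W (relPert W X') (k + 1) z : (Matrix n n ℂ)ˣ) : Matrix n n ℂ) - framePotW L (k + 1) W X' z)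
        - (mlog ((vcov L W (relPert W X) (k + 1) z : (Matrix n n ℂ)ˣ) : Matrix n n ℂ) - framePotW L (k + 1) W X z)‖
      ≤ 4 * (56 * ((d : ℝ) * L) ^ 2 + 16 * (131072 * ((d : ℝ) + 1) ^ 2) * ((d : ℝ) * L)) * ((L : ℝ) ^ (k + 1)) ^ 2 * b₁ * δ := by
  have e : X' = fun y κ => X y κ + (X' y κ - X y κ) := by funext y κ; abel
  have h := norm_frameDefect_sub_le_of_radius hL k hWu hα hα3 hα4 h52 κ₀ hx hs hWx (D := fun y κ => X' y κ - X y κ) hb hδ hX hD hb₁ hsmall hc₃ h100 hC16 hsm z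
  rw [← e] at h
  exact h

end Radius

end

end Summit.QuantumFields.BalabanUV.T4Continuum.NE7FrameDefectLipschitzRadius
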